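import Mathlib
import Literature.NumberTheory.GaloisRepresentations.GaloisRep
import Literature.NumberTheory.GaloisRepresentations.ResidualGaloisRep
import Literature.NumberTheory.GaloisRepresentations.StableLatticeValuationRing
import Summits.Langlands.Langlands.Theorems.PhantomRMYoshidaStableYoshidaCongruenceSteinbergMonodromyTame
import HarnessLib

/-!
# Route `PhantomRMYoshida`, crux `StableYoshidaCongruence` (stmt-Langlands-13640), line
# `serre-dual-ribet-square`: Stub 2a `stub_steinbergMonodromy` (assembly)

**Grothendieck's monodromy relation in the simplest case.**  Registered signature, verbatim:
for `v ∤ p` a finite place of `ℚ`, `ρ₁ : Γ_ℚ → GL₂(ℚ̄_p)` continuous with unipotent inertia at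
`v` (`(ρ₁ τ - 1)² = 0` for `τ ∈ I_𝔓`, `𝔓 ∣ v`), every `τ ∈ I_𝔓` and every arithmetic Frobenius
`φ` at `𝔓` satisfy `ρ₁(φ) N = q_v • (N ρ₁(φ))`, `N := ρ₁(τ) - 1`.

Proof (everything used is proved in the tree; no definitions, no named facts).
* `apply_frob_conj_eq_pow_of_unipotent` (**`ρ(φ τ φ⁻¹) = ρ(τ)^{q_v}`**, any number field `K`,
  any rank): take an integral model `ρ₀ : Γ_K → GL_n(ℤ̄_p)` of `ρ` over the (non-Noetherian)
  valuation ring `ℤ̄_p` of `ℚ̄_p` (`exists_integralModel_of_valuationSubring`) and reduce it modulo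
  the ideals `p^k ℤ̄_p` (`mem_span_p_pow_iff`: the closed ball of radius `‖p‖^k`, open;
  `⋂ₖ p^k ℤ̄_p = 0`, `eq_zero_of_forall_mem_span_p_pow`).  The kernel `N_k` of `ρ₀ mod p^k` is open
  (`isOpen_ker_map_mk_comp`, the proof of `isOpen_ker_residualRep`), so `Γ_K → Γ_K/N_k` is a
  continuous homomorphism to a discrete group; every `τ ∈ I_𝔓` has `p`-power order in `Γ_K/N_k`
  (`(1 + N)^{p^k} = 1 + p^k N ≡ 1`, `generalLinearGroup_map_mk_pow_eq_one`), so this quotient map is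
  tame at `𝔓` (`forall_absUpperRamificationSubgroup_apply_eq_one_of_pow_eq_one`, `p ≠ char v`) and
  Frobenius acts on its inertia image by the `q_v`-th power
  (`apply_conj_eq_pow_residueCard_of_isArithFrobAt`, the sibling file `…SteinbergMonodromyTame`):
  `ρ₀(φ τ φ⁻¹) ≡ ρ₀(τ^{q_v}) (mod p^k)` for every `k`, hence equality.
* `stub_steinbergMonodromy`: with `N = ρ₁(τ) - 1`, `N² = 0`, `ρ₁(τ)^{q_v} = 1 + q_v N`
  (`one_add_pow_eq_of_mul_self_eq_zero`), so `ρ₁(φ)(1 + N)ρ₁(φ)⁻¹ = 1 + q_v N`, i.e.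
  `ρ₁(φ) N = q_v N ρ₁(φ)`.

## References

* [SerreTate1968] J.-P. Serre, J. Tate, *Good reduction of abelian varieties*, Ann. of Math. 88
  (1968), Appendix (Grothendieck's `ℓ`-adic monodromy theorem; Frobenius acts on tame inertia by `q`).
* [SerreLocalFields1979] J.-P. Serre, *Local Fields*, GTM 67, Ch. IV §2–§3.
* [SerreAbelianLadic1968] J.-P. Serre, *Abelian ℓ-adic representations and elliptic curves*, Ch. I
  §1.1, Remark 1 (integral models of compact images).
* [DeligneSerreASENS1974] P. Deligne, J.-P. Serre, *Formes modulaires de poids 1*, 6.12 (reduction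
  of an integral model has open kernel).
-/

-- `Summit.Langlands.Langlands.…` (summit = sub-problem name, D-0017 layout) trips `dupNamespace` on every decl.
set_option linter.dupNamespace false

noncomputable section

open Ideal Literature.NumberTheory.GaloisRepresentations Field IsDedekindDomain Matrix
open scoped Pointwise NumberField MatrixGroups

namespace Summit.Langlands.Langlands.Cruxes.StableYoshidaCongruence.SerreDualRibetSquare

/-! ### Reduction of integral models modulo an ideal -/

section Reduction

variable {R : Type*} [CommRing R] {n : Type*} [Fintype n] [DecidableEq n]

/-- Two invertible matrices have the same reduction modulo `I` iff their entries agree modulo `I`.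
[folklore] -/
theorem generalLinearGroup_map_mk_eq_iff (I : Ideal R) (A B : GL n R) :
    Matrix.GeneralLinearGroup.map (Ideal.Quotient.mk I) A =
        Matrix.GeneralLinearGroup.map (Ideal.Quotient.mk I) B ↔
      ∀ i j, (A : Matrix n n R) i j - (B : Matrix n n R) i j ∈ I := by
  rw [Units.ext_iff, ← Matrix.ext_iff]
  refine forall_congr' fun i => forall_congr' fun j => ?_
  rw [Matrix.GeneralLinearGroup.map_apply, Matrix.GeneralLinearGroup.map_apply,
    Ideal.Quotient.mk_eq_mk_iff_sub_mem]

/-- **A unipotent matrix has `m`-torsion reduction modulo `m`**: if `(U - 1)² = 0` then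
`U ^ m ≡ 1 (mod m)` (`(1 + N)^m = 1 + m N`). [folklore] -/
theorem generalLinearGroup_map_mk_pow_eq_one (U : GL n R)
    (hU : ((U : Matrix n n R) - 1) * ((U : Matrix n n R) - 1) = 0) (m : ℕ) :
    Matrix.GeneralLinearGroup.map (Ideal.Quotient.mk (Ideal.span {(m : R)})) (U ^ m) = 1 := by
  set N : Matrix n n R := (U : Matrix n n R) - 1 with hN
  have hUN : (U : Matrix n n R) = 1 + N := by rw [hN]; abel
  have hm : ((m : R ⧸ Ideal.span {(m : R)})) = 0 := by
    rw [← map_natCast (Ideal.Quotient.mk (Ideal.span {(m : R)})) m,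
      Ideal.Quotient.eq_zero_iff_mem]
    exact Ideal.mem_span_singleton_self _
  refine Units.ext ?_
  rw [Matrix.GeneralLinearGroup.val_map_apply, Units.val_pow_eq_pow_val, hUN,
    Literature.NumberTheory.EllipticCurves.one_add_pow_eq_of_mul_self_eq_zero hU m,
    Units.val_one, ← nsmul_eq_mul]
  change (Ideal.Quotient.mk (Ideal.span {(m : R)})).mapMatrix (1 + m • N) = 1
  rw [map_add, map_one, map_nsmul, add_eq_left,
    ← Nat.cast_smul_eq_nsmul (R ⧸ Ideal.span {(m : R)}), hm, zero_smul]

end Reduction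

section IntegralModel

variable {F : Type*} [Field F] {O : ValuationSubring F} {n : ℕ}
variable {G : Type*} [Group G]

/-- Unipotence passes to an integral model: if `ρ₀ g = P⁻¹ ρ(g) P` entrywise in `O ⊆ F` and
`(ρ g - 1)² = 0`, then `(ρ₀ g - 1)² = 0` over `O`. [folklore] -/
theorem integralModel_sub_one_mul_self_eq_zero {ρ : G →* GL (Fin n) F} {P : GL (Fin n) F}
    {ρ₀ : G →* GL (Fin n) O}
    (h : ∀ g, Matrix.GeneralLinearGroup.map O.subtype (ρ₀ g) = P⁻¹ * ρ g * P) {g : G}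
    (hg : (((ρ g : GL (Fin n) F) : Matrix (Fin n) (Fin n) F) - 1) ^ 2 = 0) :
    (((ρ₀ g : GL (Fin n) O) : Matrix (Fin n) (Fin n) O) - 1) *
        (((ρ₀ g : GL (Fin n) O) : Matrix (Fin n) (Fin n) O) - 1) = 0 := by
  apply Matrix.map_injective (f := O.subtype) Subtype.val_injective
  change O.subtype.mapMatrix (_ * _) = O.subtype.mapMatrix 0
  rw [map_mul, map_zero, map_sub, map_one]
  have hval : O.subtype.mapMatrix ((ρ₀ g : GL (Fin n) O) : Matrix (Fin n) (Fin n) O) =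
      ((P⁻¹ * ρ g * P : GL (Fin n) F) : Matrix (Fin n) (Fin n) F) := by
    rw [← h g]; rfl
  rw [hval, Units.val_mul, Units.val_mul]
  set A : Matrix (Fin n) (Fin n) F := ((ρ g : GL (Fin n) F) : Matrix (Fin n) (Fin n) F) with hA
  set Pm : Matrix (Fin n) (Fin n) F := ((P : GL (Fin n) F) : Matrix (Fin n) (Fin n) F) with hPm
  set Pi : Matrix (Fin n) (Fin n) F := ((P⁻¹ : GL (Fin n) F) : Matrix (Fin n) (Fin n) F) with hPi
  have hPP : Pi * Pm = 1 := by rw [hPi, hPm, ← Units.val_mul, inv_mul_cancel, Units.val_one]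
  have hPP' : Pm * Pi = 1 := by rw [hPi, hPm, ← Units.val_mul, mul_inv_cancel, Units.val_one]
  have e : Pi * A * Pm - 1 = Pi * (A - 1) * Pm := by
    rw [Matrix.mul_sub, Matrix.sub_mul, Matrix.mul_one, hPP]
  rw [e]
  calc Pi * (A - 1) * Pm * (Pi * (A - 1) * Pm)
      = Pi * ((A - 1) * (Pm * Pi) * (A - 1)) * Pm := by simp only [Matrix.mul_assoc]
    _ = 0 := by rw [hPP', Matrix.mul_one, ← sq, hg, Matrix.mul_zero, Matrix.zero_mul]

/-- An integral model determines the representation: `ρ g = P ρ₀(g) P⁻¹`. [folklore] -/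
theorem eq_of_integralModel_eq {ρ : G →* GL (Fin n) F} {P : GL (Fin n) F}
    {ρ₀ : G →* GL (Fin n) O}
    (h : ∀ g, Matrix.GeneralLinearGroup.map O.subtype (ρ₀ g) = P⁻¹ * ρ g * P) {a b : G}
    (hab : ρ₀ a = ρ₀ b) : ρ a = ρ b := by
  have ha : ρ a = P * Matrix.GeneralLinearGroup.map O.subtype (ρ₀ a) * P⁻¹ := by
    rw [h a]; group
  have hb : ρ b = P * Matrix.GeneralLinearGroup.map O.subtype (ρ₀ b) * P⁻¹ := by
    rw [h b]; group
  rw [ha, hb, hab]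

variable [TopologicalSpace F] [IsTopologicalRing F] [TopologicalSpace G]

/-- **The reduction of an integral model modulo an open ideal has open kernel.**  With
`ρ₀(g) = P⁻¹ ρ(g) P ∈ GL_n(O)` an integral model of the continuous `ρ : G → GL_n(F)` and `I` an
ideal of `O` open in `F`, the kernel of `ρ₀ mod I : G → GL_n(O/I)` is open in `G` (same proof as
`isOpen_ker_residualRep`, the case `I = 𝔪`). [cite: DeligneSerreASENS1974, 6.12] -/
theorem isOpen_ker_map_mk_comp (I : Ideal O)
    (hI : IsOpen {x : F | ∃ h : x ∈ O, (⟨x, h⟩ : O) ∈ I})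
    {ρ : G →ₜ* GL (Fin n) F} {P : GL (Fin n) F} {ρ₀ : G →* GL (Fin n) O}
    (h : ∀ g, Matrix.GeneralLinearGroup.map O.subtype (ρ₀ g) = P⁻¹ * ρ g * P) :
    IsOpen (((Matrix.GeneralLinearGroup.map (Ideal.Quotient.mk I)).comp ρ₀).ker : Set G) := by
  -- adapted from `Literature.NumberTheory.GaloisRepresentations.isOpen_ker_residualRep`
  let y : G → Fin n → Fin n → O := fun g i j ↦
    ((ρ₀ g : GL (Fin n) O) : Matrix (Fin n) (Fin n) O) i j - (1 : Matrix (Fin n) (Fin n) O) i j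
  have hker : (((Matrix.GeneralLinearGroup.map (Ideal.Quotient.mk I)).comp ρ₀).ker : Set G) =
      ⋂ i, ⋂ j, {g | y g i j ∈ I} := by
    ext g
    simp only [SetLike.mem_coe, MonoidHom.mem_ker, MonoidHom.comp_apply, Set.mem_iInter,
      Set.mem_setOf_eq]
    rw [← (Matrix.GeneralLinearGroup.map (Ideal.Quotient.mk I)).map_one,
      generalLinearGroup_map_mk_eq_iff]
    rfl
  rw [hker]
  refine isOpen_iInter_of_finite fun i ↦ isOpen_iInter_of_finite fun j ↦ ?_
  have hset : {g | y g i j ∈ I} =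
      (fun g : G ↦ ((P⁻¹ * ρ g * P : GL (Fin n) F) : Matrix (Fin n) (Fin n) F) i j -
        (1 : Matrix (Fin n) (Fin n) F) i j) ⁻¹' {x : F | ∃ h : x ∈ O, (⟨x, h⟩ : O) ∈ I} := by
    ext g
    have hval : ((P⁻¹ * ρ g * P : GL (Fin n) F) : Matrix (Fin n) (Fin n) F) i j -
        (1 : Matrix (Fin n) (Fin n) F) i j = (y g i j : F) := by
      rw [← h g]
      by_cases hij' : i = j
      · subst hij'
        simp [y, Matrix.GeneralLinearGroup.map]
      · simp [y, Matrix.GeneralLinearGroup.map, Matrix.one_apply_ne hij']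
    simp only [Set.mem_setOf_eq, Set.mem_preimage, hval, Subtype.coe_eta, SetLike.coe_mem,
      exists_true_left]
  rw [hset]
  refine hI.preimage ?_
  have hc : Continuous fun g : G ↦ ((P⁻¹ * ρ g * P : GL (Fin n) F) : Matrix (Fin n) (Fin n) F) :=
    Units.continuous_val.comp ((continuous_const.mul ρ.continuous_toFun).mul continuous_const)
  exact (hc.matrix_elem i j).sub continuous_const

end IntegralModel

/-! ### The ideals `p^k ℤ̄_p` of the valuation ring of `ℚ̄_p` -/

section PadicAlgCl

variable (p : ℕ) [Fact p.Prime]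

/-- `‖p‖ < 1` and `0 < ‖p‖` in `ℚ̄_p`. [folklore] -/
theorem norm_p_lt_one_and_pos :
    ‖(p : PadicAlgCl p)‖ < 1 ∧ 0 < ‖(p : PadicAlgCl p)‖ := by
  have h : ‖(p : PadicAlgCl p)‖ = ‖(p : ℚ_[p])‖ := by
    rw [← map_natCast (algebraMap ℚ_[p] (PadicAlgCl p)) p]
    exact PadicAlgCl.norm_extends p (p : ℚ_[p])
  rw [h]
  exact ⟨Padic.norm_p_lt_one, norm_pos_iff.mpr (Nat.cast_ne_zero.mpr (Fact.out : p.Prime).ne_zero)⟩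

/-- Membership in `p^k ℤ̄_p`: for `x ∈ ℤ̄_p`, `x ∈ (p^k)` iff `‖x‖ ≤ ‖p‖^k`. [folklore] -/
theorem mem_span_p_pow_iff (k : ℕ) (x : padicAlgClIntegers p) :
    x ∈ Ideal.span {(p : padicAlgClIntegers p) ^ k} ↔
      ‖(x : PadicAlgCl p)‖ ≤ ‖(p : PadicAlgCl p)‖ ^ k := by
  obtain ⟨hp1, hp0⟩ := norm_p_lt_one_and_pos p
  rw [Ideal.mem_span_singleton]
  constructor
  · rintro ⟨c, rfl⟩
    have hc : ‖((c : padicAlgClIntegers p) : PadicAlgCl p)‖ ≤ 1 := by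
      have := c.2
      rw [Valuation.mem_valuationSubring_iff] at this
      exact this
    push_cast
    rw [norm_mul, norm_pow]
    exact mul_le_of_le_one_right (pow_nonneg (norm_nonneg _) _) hc
  · intro hx
    have hpk : ((p : PadicAlgCl p)) ^ k ≠ 0 := pow_ne_zero _ (norm_pos_iff.mp hp0)
    set c : PadicAlgCl p := (x : PadicAlgCl p) / (p : PadicAlgCl p) ^ k with hc
    have hcO : c ∈ padicAlgClIntegers p := by
      rw [Valuation.mem_valuationSubring_iff]
      change ‖c‖₊ ≤ 1
      rw [← NNReal.coe_le_coe, coe_nnnorm, NNReal.coe_one, hc, norm_div, norm_pow]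
      exact div_le_one_of_le₀ hx (pow_nonneg (norm_nonneg _) _)
    refine ⟨⟨c, hcO⟩, Subtype.ext ?_⟩
    push_cast
    rw [hc, mul_div_cancel₀ _ hpk]

/-- The subset of `ℚ̄_p` underlying `p^k ℤ̄_p` is the closed ball of radius `‖p‖^k`, which is open
(ultrametric). [folklore] -/
theorem isOpen_setOf_mem_span_p_pow (k : ℕ) :
    IsOpen {x : PadicAlgCl p | ∃ h : x ∈ padicAlgClIntegers p,
      (⟨x, h⟩ : padicAlgClIntegers p) ∈ Ideal.span {(p : padicAlgClIntegers p) ^ k}} := by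
  obtain ⟨hp1, hp0⟩ := norm_p_lt_one_and_pos p
  have hset : {x : PadicAlgCl p | ∃ h : x ∈ padicAlgClIntegers p,
      (⟨x, h⟩ : padicAlgClIntegers p) ∈ Ideal.span {(p : padicAlgClIntegers p) ^ k}} =
      Metric.closedBall (0 : PadicAlgCl p) (‖(p : PadicAlgCl p)‖ ^ k) := by
    ext x
    simp only [Set.mem_setOf_eq, Metric.mem_closedBall, dist_zero_right, mem_span_p_pow_iff]
    constructor
    · rintro ⟨-, hx⟩
      exact hx
    · intro hx
      refine ⟨?_, hx⟩
      rw [Valuation.mem_valuationSubring_iff]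
      change ‖x‖₊ ≤ 1
      rw [← NNReal.coe_le_coe, coe_nnnorm, NNReal.coe_one]
      exact hx.trans (pow_le_one₀ (norm_nonneg _) hp1.le)
  rw [hset]
  exact IsUltrametricDist.isOpen_closedBall _ (pow_ne_zero _ hp0.ne')

/-- `⋂ₖ p^k ℤ̄_p = 0` (`ℤ̄_p` is `p`-adically separated). [folklore] -/
theorem eq_zero_of_forall_mem_span_p_pow (x : padicAlgClIntegers p)
    (hx : ∀ k : ℕ, x ∈ Ideal.span {(p : padicAlgClIntegers p) ^ k}) : x = 0 := by
  obtain ⟨hp1, hp0⟩ := norm_p_lt_one_and_pos p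
  by_contra h0
  have hx0 : 0 < ‖(x : PadicAlgCl p)‖ := by
    rw [norm_pos_iff]
    exact fun h => h0 (Subtype.ext h)
  obtain ⟨k, hk⟩ := exists_pow_lt_of_lt_one hx0 hp1
  exact (not_le.mpr hk) ((mem_span_p_pow_iff p k x).mp (hx k))

end PadicAlgCl

/-! ### Grothendieck's monodromy relation on inertia -/

section Monodromy

variable {K : Type} [Field K] [NumberField K] (p : ℕ) [Fact p.Prime] {n : ℕ}

set_option synthInstance.maxHeartbeats 200000 in
/-- **`ρ(φ τ φ⁻¹) = ρ(τ)^{q_v}` for unipotent inertia at `v ∤ p`.**  Let `K` be a number field,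
`ρ : Γ_K → GL_n(ℚ̄_p)` continuous, `v ∤ p` a finite place such that every inertia element at `v`
acts unipotently with `(ρ τ - 1)² = 0`.  Then for every prime `𝔓 ∣ v` of `\bar ℤ_K`, every
`τ ∈ I_𝔓` and every arithmetic Frobenius `φ` at `𝔓`, `ρ(φ τ φ⁻¹) = ρ(τ)^{q_v}`.
Proof: take an integral model `ρ₀ : Γ_K → GL_n(ℤ̄_p)` (`exists_integralModel_of_valuationSubring`)
and reduce modulo `p^k`: the kernel `N_k` is open (`isOpen_ker_map_mk_comp`), every `τ ∈ I_𝔓`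
has `p`-power order in `Γ_K/N_k` (`(1 + N)^{p^k} = 1 + p^k N`), so `Γ_K → Γ_K/N_k` is tame at `𝔓`
(`forall_absUpperRamificationSubgroup_apply_eq_one_of_pow_eq_one`) and Frobenius acts on its
inertia image by the `q_v`-th power (`apply_conj_eq_pow_residueCard_of_isArithFrobAt`); hence
`ρ₀(φ τ φ⁻¹) ≡ ρ₀(τ^{q_v}) (mod p^k)` for all `k`, so they are equal (`⋂ p^k ℤ̄_p = 0`).
[cite: SerreTate1968, Appendix (Grothendieck's monodromy theorem); SerreLocalFields1979, Ch. IV §2] -/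
theorem apply_frob_conj_eq_pow_of_unipotent (v : HeightOneSpectrum (𝓞 K))
    (ρ : FramedGaloisRep K (PadicAlgCl p) n) (hv : ((p : ℕ) : 𝓞 K) ∉ v.asIdeal)
    (huni : ∀ 𝔓 ∈ v.primesAbove, ∀ τ ∈ 𝔓.inertia (absoluteGaloisGroup K),
      (((ρ τ : GL (Fin n) (PadicAlgCl p)) : Matrix (Fin n) (Fin n) (PadicAlgCl p)) - 1) ^ 2 = 0)
    {𝔓 : Ideal (absIntegers (𝓞 K) K)} (h𝔓 : 𝔓 ∈ v.primesAbove)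
    {τ : absoluteGaloisGroup K} (hτ : τ ∈ 𝔓.inertia (absoluteGaloisGroup K))
    {φ : absoluteGaloisGroup K} (hφ : IsArithFrobAt (𝓞 K) φ 𝔓) :
    ρ (φ * τ * φ⁻¹) = ρ τ ^ v.residueCard := by
  classical
  have hp : p.Prime := Fact.out
  -- an integral model over `ℤ̄_p`
  set O : ValuationSubring (PadicAlgCl p) := padicAlgClIntegers p with hO
  have hOopen : IsOpen (O : Set (PadicAlgCl p)) := Valued.isOpen_valuationSubring _
  obtain ⟨P, ρ₀, hρ₀⟩ := exists_integralModel_of_valuationSubring (O := O) hOopen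
    (ρ : FramedGaloisRep K (PadicAlgCl p) n)
  -- it suffices to compare the integral model modulo every `p^k`
  rw [← map_pow]
  refine eq_of_integralModel_eq hρ₀ (Units.ext (Matrix.ext fun i j => ?_))
  rw [← sub_eq_zero]
  refine eq_zero_of_forall_mem_span_p_pow p _ fun k => ?_
  set I : Ideal O := Ideal.span {(p : O) ^ k} with hI
  set f : absoluteGaloisGroup K →* GL (Fin n) (O ⧸ I) :=
    (Matrix.GeneralLinearGroup.map (Ideal.Quotient.mk I)).comp ρ₀ with hf
  revert i j
  rw [← generalLinearGroup_map_mk_eq_iff]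
  change f (φ * τ * φ⁻¹) = f (τ ^ v.residueCard)
  -- the finite quotient `Γ_K / ker f`, a discrete group
  set N : Subgroup (absoluteGaloisGroup K) := f.ker with hN
  have hNopen : IsOpen (N : Set (absoluteGaloisGroup K)) :=
    isOpen_ker_map_mk_comp I (isOpen_setOf_mem_span_p_pow p k) hρ₀
  haveI : N.Normal := MonoidHom.normal_ker f
  haveI : DiscreteTopology (absoluteGaloisGroup K ⧸ N) := QuotientGroup.discreteTopology hNopen
  let F : absoluteGaloisGroup K →ₜ* absoluteGaloisGroup K ⧸ N :=
    ⟨QuotientGroup.mk' N, QuotientGroup.continuous_mk⟩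
  have hF : ∀ g, F g = QuotientGroup.mk g := fun g => rfl
  -- inertia has `p`-power order in `Γ_K / N`
  have hpow : ∀ σ ∈ 𝔓.inertia (absoluteGaloisGroup K), ∃ m : ℕ, F σ ^ p ^ m = 1 := by
    intro σ hσ
    refine ⟨k, ?_⟩
    rw [← map_pow, hF, QuotientGroup.eq_one_iff, hN, MonoidHom.mem_ker, hf, MonoidHom.comp_apply,
      map_pow, hI, ← Nat.cast_pow]
    exact generalLinearGroup_map_mk_pow_eq_one (ρ₀ σ)
      (integralModel_sub_one_mul_self_eq_zero hρ₀ (huni 𝔓 h𝔓 σ hσ)) (p ^ k)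
  have htame := forall_absUpperRamificationSubgroup_apply_eq_one_of_pow_eq_one h𝔓 F hp hv hpow
  have hlaw := apply_conj_eq_pow_residueCard_of_isArithFrobAt h𝔓 F htame hτ hφ
  rw [← map_pow, hF, hF, QuotientGroup.eq, hN, MonoidHom.mem_ker, map_mul, map_inv,
    inv_mul_eq_one] at hlaw
  exact hlaw

end Monodromy

/-! ### The registered stub -/

/-- **Stub 2a (`stub_steinbergMonodromy`, CORE) — Grothendieck's monodromy relation in the
simplest case.**  Let `v ∤ p` be a finite place of `ℚ`, `ρ₁ : Γ_ℚ → GL₂(ℚ̄_p)` continuous with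
every inertia element at `v` acting unipotently (`(ρ₁ τ - 1)² = 0` for `τ ∈ I_𝔓`, `𝔓 ∣ v`).  Then
for every `𝔓 ∣ v`, every `τ ∈ I_𝔓` and every arithmetic Frobenius `φ` at `𝔓`, with
`N := ρ₁(τ) - 1`:
`ρ₁(φ) N = q_v • (N ρ₁(φ))`.  Proof: `ρ₁(φ τ φ⁻¹) = ρ₁(τ)^{q_v}`
(`apply_frob_conj_eq_pow_of_unipotent`) and `(1 + N)^{q_v} = 1 + q_v N`, so
`ρ₁(φ) (1 + N) ρ₁(φ)⁻¹ = 1 + q_v N`.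
[cite: SerreTate1968, Appendix; SerreLocalFields1979, Ch. IV §2 Prop. 7 and §3] -/
theorem stub_steinbergMonodromy :
    ∀ (p : ℕ) [Fact p.Prime] (v : HeightOneSpectrum (NumberField.RingOfIntegers ℚ))
      (ρ₁ : FramedGaloisRep ℚ (PadicAlgCl p) 2),
      ((p : ℕ) : NumberField.RingOfIntegers ℚ) ∉ v.asIdeal →
      (∀ 𝔓 ∈ v.primesAbove, ∀ τ ∈ 𝔓.inertia (Field.absoluteGaloisGroup ℚ),
        (((ρ₁ τ : GL (Fin 2) (PadicAlgCl p)) : Matrix (Fin 2) (Fin 2) (PadicAlgCl p)) - 1) ^ 2 = 0) →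
      ∀ 𝔓 ∈ v.primesAbove, ∀ τ ∈ 𝔓.inertia (Field.absoluteGaloisGroup ℚ),
        ∀ φ : Field.absoluteGaloisGroup ℚ, IsArithFrobAt (NumberField.RingOfIntegers ℚ) φ 𝔓 →
          ((ρ₁ φ : GL (Fin 2) (PadicAlgCl p)) : Matrix (Fin 2) (Fin 2) (PadicAlgCl p)) *
              (((ρ₁ τ : GL (Fin 2) (PadicAlgCl p)) : Matrix (Fin 2) (Fin 2) (PadicAlgCl p)) - 1) =
            (v.residueCard : PadicAlgCl p) •
              ((((ρ₁ τ : GL (Fin 2) (PadicAlgCl p)) : Matrix (Fin 2) (Fin 2) (PadicAlgCl p)) - 1) *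
                ((ρ₁ φ : GL (Fin 2) (PadicAlgCl p)) : Matrix (Fin 2) (Fin 2) (PadicAlgCl p))) := by
  intro p _ v ρ₁ hv huni 𝔓 h𝔓 τ hτ φ hφ
  have hstar := apply_frob_conj_eq_pow_of_unipotent p v ρ₁ hv huni h𝔓 hτ hφ
  rw [map_mul, map_mul, map_inv] at hstar
  have hmat :=
    congrArg (fun g : GL (Fin 2) (PadicAlgCl p) => (g : Matrix (Fin 2) (Fin 2) (PadicAlgCl p))) hstar
  simp only [Units.val_mul, Units.val_pow_eq_pow_val] at hmat
  set q : ℕ := v.residueCard with hq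
  set Fm : Matrix (Fin 2) (Fin 2) (PadicAlgCl p) :=
    ((ρ₁ φ : GL (Fin 2) (PadicAlgCl p)) : Matrix (Fin 2) (Fin 2) (PadicAlgCl p)) with hFm
  set Fi : Matrix (Fin 2) (Fin 2) (PadicAlgCl p) :=
    (((ρ₁ φ)⁻¹ : GL (Fin 2) (PadicAlgCl p)) : Matrix (Fin 2) (Fin 2) (PadicAlgCl p)) with hFi
  set U : Matrix (Fin 2) (Fin 2) (PadicAlgCl p) :=
    ((ρ₁ τ : GL (Fin 2) (PadicAlgCl p)) : Matrix (Fin 2) (Fin 2) (PadicAlgCl p)) with hU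
  have hN : (U - 1) * (U - 1) = 0 := by rw [← sq]; exact huni 𝔓 h𝔓 τ hτ
  have hFF : Fm * Fi = 1 := by rw [hFm, hFi, ← Units.val_mul, mul_inv_cancel, Units.val_one]
  have hFF' : Fi * Fm = 1 := by rw [hFm, hFi, ← Units.val_mul, inv_mul_cancel, Units.val_one]
  -- `U ^ q = 1 + q • (U - 1)`
  have hUq : U ^ q = 1 + (q : PadicAlgCl p) • (U - 1) := by
    rw [show U = 1 + (U - 1) by abel,
      Literature.NumberTheory.EllipticCurves.one_add_pow_eq_of_mul_self_eq_zero hN q,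
      ← nsmul_eq_mul, Nat.cast_smul_eq_nsmul, add_sub_cancel_left]
  -- `F N F⁻¹ = q • N`
  have hconj : Fm * (U - 1) * Fi = (q : PadicAlgCl p) • (U - 1) := by
    rw [Matrix.mul_sub, Matrix.sub_mul, Matrix.mul_one, hmat, hFF, hUq, add_sub_cancel_left]
  calc Fm * (U - 1) = Fm * (U - 1) * (Fi * Fm) := by rw [hFF', Matrix.mul_one]
    _ = Fm * (U - 1) * Fi * Fm := by simp only [Matrix.mul_assoc]
    _ = (q : PadicAlgCl p) • (U - 1) * Fm := by rw [hconj]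
    _ = (q : PadicAlgCl p) • ((U - 1) * Fm) := Matrix.smul_mul _ _ _


end Summit.Langlands.Langlands.Cruxes.StableYoshidaCongruence.SerreDualRibetSquare

end
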